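import Mathlib
import HarnessLib
import Summits.HubbardSuperconductivity.HubbardSuperconductivity.Theorems.KLProgrammeKLRegimeSectorSlicePairWtFatIncr
import Summits.HubbardSuperconductivity.HubbardSuperconductivity.Theorems.KLProgrammeKLRegimeSectorSliceDefectRowsFat

/-!
# Route `KLProgramme` — crux K3 ENGINE (stmt-HubbardSuperconductivity-20437) stub (b) conj. 2 «(c-D)² FAMILY TELESCOPE», brick (D5c-all): the per-pair
# weighted bound of the fat increment pair for EVERY pair — the integer frame vector built from the sector's Fermi point

Cell `gate-hubbard-kl`, seat hubbard-kl-k3c3-p2 (g11).  `slicePairWt_bgmFatIncr_le` (`…SectorSlicePairWtFatIncr`) asks for an integer tangent vector `v`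
of the sector `ω` (`|v_j| ≤ N_r + ½`, `|v| ≥ N_r − 1`, tangency `|De_K(p_F(θ_ω))·(2π/L)v| ≤ |2π/L|(4+2A)`); as in k3c2-p3's `slicePair_bgmFat_le_all` /
k3c4-p2's `sliceDefectPairWt_bgmFat_le_all` it is `v = round(N_r·t̂)` with `t̂` the unit tangent at `p_F(θ_ω)` (`tangentStep_bounds`,
`sub_one_le_sqrt_sum_sq_round`), and the lattice-resolution hypothesis along `v` follows from the uniform one `K_{b,2}·(2π/L)·√2(N_r+½) ≤ b_s`.

* **`slicePairWt_bgmFatIncr_le_all`** — the conclusion of `slicePairWt_bgmFatIncr_le` for every pair `(ω, ω′)`, no frame-vector hypotheses left.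

Everything is proved; no definitions, no sorry.  Nothing asserts superconductivity. [cite: BenfattoGiulianiMastropietro2006, §2.8 (2.81), §3 (3.2)–(3.8)]
-/

noncomputable section

namespace Summit.HubbardSuperconductivity.HubbardSuperconductivity.Theorems.TorusFourierL2

set_option linter.dupNamespace false -- summit = problem name (single-conjunct summit), D-0017

open Set Finset Filter Topology Literature.MathematicalPhysics.QuantumLattice Literature.MathematicalPhysics.QuantumLattice.BandSectorCounting
open Literature.MathematicalPhysics.QuantumLattice.FermiRG Literature.Probability.LatticeModels Literature.Analysis.SpecialFunctions Literature.Analysis.Calculus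
open Summit.HubbardSuperconductivity.HubbardSuperconductivity.Theorems.DispersionFlow
open Summit.HubbardSuperconductivity.HubbardSuperconductivity.Theorems.KLRegimeSplit
open Summit.HubbardSuperconductivity.HubbardSuperconductivity.Theorems.KLProgrammeLegKernels
open Summit.HubbardSuperconductivity.HubbardSuperconductivity.Theorems.PerturbedFermiCurve
open scoped Real Nat

section PairBoundAll

open Classical

variable {L M : ℕ} [NeZero L] [NeZero M] {a b : ℝ} (B : BandBounds a b) {K : TrigPolyC4v} (Ko Kb : TrigPolyC4v) {A A₃ : ℝ}
  (hA : ∀ p : Momentum, ∀ j ≤ 2, ‖iteratedFDeriv ℝ j (frameShift K) p‖ ≤ A) (hA3 : ∀ p : Momentum, ‖iteratedFDeriv ℝ 3 (frameShift K) p‖ ≤ A₃)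
  (hADt : 2 * A < B.Dtmin)
  {μ e₀ z β : ℝ} (he : 0 < e₀) (hz : 0 < z) (hz1 : z ≤ 1) (hgap : e₀ + A + z ^ 2 < -μ) (h3 : e₀ + A - μ ≤ 3)
  (hlo : a ≤ μ - A - e₀) (hhi : μ + A + e₀ ≤ b) (hβ : 0 < β) (hρA : 4 * A < 2 * B.rhomin)
  (m : ℕ) (hMm : klScale e₀ m * β < π * (2 * M - 5))
  {d : ℝ} (hd : 0 ≤ d) (hd1 : ∀ u, |deriv (bgmCutoffSq e₀) u| ≤ d) (hd2 : ∀ u, |iteratedDeriv 2 (bgmCutoffSq e₀) u| ≤ d)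
  (hd3 : ∀ u, |iteratedDeriv 3 (bgmCutoffSq e₀) u| ≤ d) (hd4 : ∀ u, |iteratedDeriv 4 (bgmCutoffSq e₀) u| ≤ d)
  {Ba : ℝ} (hB0 : 0 ≤ Ba)
  (hB : ∀ (i : ℕ), i ≤ 3 → ∀ (n : ℕ) (ω : ℤ) (θ₀ : ℝ) (q w : Fin 2 → ℝ) (t : ℝ) {r₀ : ℝ}, 0 < r₀ →
    r₀ ≤ ‖momToComplex (q + t • w)‖ → |sectorRelAngle θ₀ (q + t • w)| < π →
    ‖iteratedDeriv i (fun t : ℝ => sectorWeightCirc n ω (polarAngle (q + t • w))) t‖ ≤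
      (3 : ℕ)! * Ba * ((1 + (sectorWidth n)⁻¹ * (3 : ℕ)!) * ‖momToComplex w‖ / r₀) ^ i)
  {K₂ : ℝ} (hK₂ : ∀ p, ‖iteratedFDeriv ℝ 2 (frameLevel μ K) p‖ ≤ K₂)
  {Nr : ℝ} (hNr : 2 ≤ Nr) (hLz : 3 * |2 * π / L| * (Nr + 1 / 2) ≤ z)
  -- the piece `ν = e_K − e_{K_o}` in the two-scale class at depth `x`
  {ν : (Fin 2 → ℝ) → ℝ} (hν : ∀ p, ν p = frameLevel μ K (WithLp.toLp 2 p) - frameLevel μ Ko (WithLp.toLp 2 p)) (hνs : ContDiff ℝ 3 ν)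
  {x G₀ G₁ G₂ G₃ ε₃₀ ε₃₁ : ℝ} (hx : 1 ≤ x) (hG₀ : 0 < G₀) (hG₁ : 0 ≤ G₁) (hG₂ : 0 ≤ G₂) (hG₃ : 0 ≤ G₃) (hε₃₀ : 0 ≤ ε₃₀) (hε₃₁ : 0 ≤ ε₃₁)
  (hN₀ : ∀ p, |ν p| ≤ G₀ / x ^ 2) (hN₁ : ∀ p, ‖fderiv ℝ ν p‖ ≤ G₁ / x) (hN₂ : ∀ p, ‖iteratedFDeriv ℝ 2 ν p‖ ≤ G₂)
  (hN₃ : ∀ p, ‖iteratedFDeriv ℝ 3 ν p‖ ≤ G₃ * x) (hGΛ : G₀ / x ^ 2 ≤ klScale e₀ m) (hA₃x : 4 + 8 * A₃ ≤ ε₃₀ + ε₃₁ * x)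
  -- the band frame `K_b`: slice, jets in the class, cutoff, tangency transfer
  {Λ Λ' : ℝ} (hΛ : 0 < Λ) (hΛΛ' : Λ ≤ Λ') (hM' : Λ' < π * (2 * M - 5) / β)
  {Kb₁ Kb₂ Kb₃ : ℝ} (hKb₁ : ∀ p, ‖fderiv ℝ (frameLevel μ Kb) p‖ ≤ Kb₁) (hKb₂ : ∀ p, ‖iteratedFDeriv ℝ 2 (frameLevel μ Kb) p‖ ≤ Kb₂)
  (hKb₃ : ∀ p, ‖iteratedFDeriv ℝ 3 (frameLevel μ Kb) p‖ ≤ Kb₃)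
  {bs b₂ b₂' b₃ b₃' : ℝ} (hbs : 0 ≤ bs) (hKb₁b : Kb₁ ≤ bs) (hKb₂x : Kb₂ ≤ b₂ + b₂' * x) (hKb₃x : Kb₃ ≤ b₃ + b₃' * x)
  {B₁ B₂ B₃ : ℝ} (hB₁ : ∀ x, |deriv salmhoferCutoff x| ≤ B₁) (hB₂ : ∀ x, |deriv (deriv salmhoferCutoff) x| ≤ B₂)
  (hB₃ : ∀ x, |deriv (deriv (deriv salmhoferCutoff)) x| ≤ B₃)
  {Nt : ℝ} (hNt0 : 0 ≤ Nt)
  (hNt : ∀ (y w : EuclideanSpace ℝ (Fin 2)), |fderiv ℝ (frameLevel μ Kb) y w - fderiv ℝ (frameLevel μ K) y w| ≤ Nt * ‖w‖)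
  -- the names (instantiate with `rfl`): common, iso family, tangent family, time
  {ρf κ C₁ B₀x ε₂ ζ t 𝔮₁ 𝔮₂ 𝔮₃₀ 𝔮₃₁ d₁ w₁ d₂ w₂ d₃₀ d₃₁ w₃₀ w₃₁ o₁₀ o₁₁ o₂₀ o₂₁ o₂₂ o₃₀ o₃₁ o₃₂ o₃₃
    R₁₀ R₁₁ R₂₀ R₂₁ R₂₂ R₃₀ R₃₁ R₃₂ R₃₃ r₁₀ r₁₁ r₂₀ r₂₁ r₂₂ r₃₀ r₃₁ r₃₂ r₃₃
    tv 𝔳₁ 𝔳₂ 𝔳₃₀ 𝔳₃₁ dv₁ wv₁ dv₂ wv₂ dv₃₀ dv₃₁ wv₃₀ wv₃₁ ov₁₀ ov₁₁ ov₂₀ ov₂₁ ov₂₂ ov₃₀ ov₃₁ ov₃₂ ov₃₃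
    Rv₁₀ Rv₁₁ Rv₂₀ Rv₂₁ Rv₂₂ Rv₃₀ Rv₃₁ Rv₃₂ Rv₃₃ rv₁₀ rv₁₁ rv₂₀ rv₂₁ rv₂₂ rv₃₀ rv₃₁ rv₃₂ rv₃₃
    qt₁ qt₂ qt₃ Dt₁ Dt₂ θ₁ θ₂ θ₃ : ℝ}
  (hρf : ρf = (klScale e₀ m + B.smax * B.Dtmin * (3 * sectorWidth (m + 1) / 4)) / (B.Dtmin - 2 * A) +
    π * Real.sqrt 2 * (1 + (4 + 2 * A) / (B.Dtmin - 2 * A)) * sectorWidth (m + 1))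
  (hκ : κ = e₀ ^ 2 / klScale e₀ m ^ 2) (hC₁ : C₁ = d * e₀ ^ 2 / klScale e₀ m ^ 2)
  (hB₀x : B₀x = C₁ * (G₀ / x ^ 2 * (2 * (klScale e₀ m + G₀ / x ^ 2) + G₀ / x ^ 2)))
  (hε₂ : ε₂ = 4 + 4 * A) (hζ : ζ = 1 + 6 * (sectorWidth (m + 1))⁻¹)
  -- iso family (`t = 4 + 2A`)
  (ht : t = 4 + 2 * A)
  (h𝔮₁ : 𝔮₁ = 2 * (d * e₀ ^ 2) * t / klScale e₀ m + 9 * (12 * Ba * ζ))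
  (h𝔮₂ : 𝔮₂ = (4 * (d * e₀ ^ 4) + 2 * (d * e₀ ^ 2)) * t ^ 2 / klScale e₀ m ^ 2 + 2 * (d * e₀ ^ 2) * (4 + 4 * A) / klScale e₀ m +
    4 * (d * e₀ ^ 2) * t / klScale e₀ m * (9 * (12 * Ba * ζ)) + 9 * ((12 * Ba + 72 * Ba ^ 2) * ζ ^ 2))
  (h𝔮₃₀ : 𝔮₃₀ = (8 * (d * e₀ ^ 6) + 12 * (d * e₀ ^ 4)) * t ^ 3 / klScale e₀ m ^ 3 + (12 * (d * e₀ ^ 4) + 6 * (d * e₀ ^ 2)) * (t * (4 + 4 * A)) / klScale e₀ m ^ 2 +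
    2 * (d * e₀ ^ 2) * ε₃₀ / klScale e₀ m +
    3 * (((4 * (d * e₀ ^ 4) + 2 * (d * e₀ ^ 2)) * t ^ 2 / klScale e₀ m ^ 2 + 2 * (d * e₀ ^ 2) * (4 + 4 * A) / klScale e₀ m) * (9 * (12 * Ba * ζ))) +
    3 * (2 * (d * e₀ ^ 2) * t / klScale e₀ m * (9 * ((12 * Ba + 72 * Ba ^ 2) * ζ ^ 2))) + 9 * ((12 * Ba + 216 * Ba ^ 2) * ζ ^ 3))
  (h𝔮₃₁ : 𝔮₃₁ = 2 * (d * e₀ ^ 2) * ε₃₁ / klScale e₀ m)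
  (hd₁ : d₁ = 4 * klScale e₀ m * t) (hw₁ : w₁ = 2 * (t * G₀ + 2 * klScale e₀ m * G₁ + G₀ * G₁)) (hd₂ : d₂ = 2 * (t ^ 2 + 2 * klScale e₀ m * ε₂))
  (hw₂ : w₂ = 2 * (ε₂ * G₀ + 2 * t * G₁ + 2 * klScale e₀ m * G₂ + G₁ ^ 2 + G₀ * G₂))
  (hd₃₀ : d₃₀ = 2 * (3 * t * ε₂ + 2 * klScale e₀ m * ε₃₀)) (hd₃₁ : d₃₁ = 4 * klScale e₀ m * ε₃₁)
  (hw₃₀ : w₃₀ = 2 * (ε₃₀ * G₀ + ε₃₁ * G₀ + 3 * ε₂ * G₁ + 3 * t * G₂ + 3 * G₁ * G₂ + G₀ * G₃)) (hw₃₁ : w₃₁ = 4 * klScale e₀ m * G₃)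
  (ho₁₀ : o₁₀ = t / klScale e₀ m) (ho₁₁ : o₁₁ = 2 * G₁ / G₀) (ho₂₀ : o₂₀ = ε₂ / klScale e₀ m + G₁ ^ 2 / (klScale e₀ m * G₀))
  (ho₂₁ : o₂₁ = 2 * t * G₁ / (klScale e₀ m * G₀)) (ho₂₂ : o₂₂ = 2 * G₂ / G₀)
  (ho₃₀ : o₃₀ = ε₃₀ / klScale e₀ m) (ho₃₁ : o₃₁ = ε₃₁ / klScale e₀ m + 3 * ε₂ * G₁ / (klScale e₀ m * G₀) + 3 * G₁ * G₂ / (klScale e₀ m * G₀))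
  (ho₃₂ : o₃₂ = 3 * t * G₂ / (klScale e₀ m * G₀)) (ho₃₃ : o₃₃ = 2 * G₃ / G₀)
  (hR₁₀ : R₁₀ = κ * (d₁ + w₁) + o₁₀) (hR₁₁ : R₁₁ = o₁₁)
  (hR₂₀ : R₂₀ = κ ^ 2 * (d₁ + w₁) ^ 2 + κ * (o₁₀ * (2 * d₁ + w₁)) + κ * (d₂ + w₂) + o₂₀) (hR₂₁ : R₂₁ = κ * (o₁₁ * (2 * d₁ + w₁)) + o₂₁)
  (hR₂₂ : R₂₂ = o₂₂)
  (hR₃₀ : R₃₀ = κ ^ 3 * (d₁ + w₁) ^ 3 + κ ^ 2 * (o₁₀ * (3 * d₁ ^ 2 + 3 * d₁ * w₁ + w₁ ^ 2)) +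
    3 * (κ ^ 2 * ((d₁ + w₁) * (d₂ + w₂)) + κ * (d₁ * o₂₀ + o₁₀ * d₂ + o₁₀ * w₂)) + κ * (d₃₀ + w₃₀) + o₃₀)
  (hR₃₁ : R₃₁ = κ ^ 2 * (o₁₁ * (3 * d₁ ^ 2 + 3 * d₁ * w₁ + w₁ ^ 2)) + 3 * (κ * (d₁ * o₂₁ + o₁₁ * d₂ + o₁₁ * w₂)) + κ * (d₃₁ + w₃₁) + o₃₁)
  (hR₃₂ : R₃₂ = 3 * (κ * (d₁ * o₂₂)) + o₃₂) (hR₃₃ : R₃₃ = o₃₃)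
  (hr₁₀ : r₁₀ = R₁₀ + 𝔮₁) (hr₁₁ : r₁₁ = R₁₁) (hr₂₀ : r₂₀ = R₂₀ + 2 * R₁₀ * 𝔮₁ + 𝔮₂) (hr₂₁ : r₂₁ = R₂₁ + 2 * R₁₁ * 𝔮₁) (hr₂₂ : r₂₂ = R₂₂)
  (hr₃₀ : r₃₀ = R₃₀ + 3 * R₂₀ * 𝔮₁ + 3 * R₁₀ * 𝔮₂ + 𝔮₃₀) (hr₃₁ : r₃₁ = R₃₁ + 3 * R₂₁ * 𝔮₁ + 3 * R₁₁ * 𝔮₂ + 𝔮₃₁)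
  (hr₃₂ : r₃₂ = R₃₂ + 3 * R₂₂ * 𝔮₁) (hr₃₃ : r₃₃ = R₃₃)
  -- tangent family (`t_v = (4+2A)/(N_r−1) + K₂√2ρ_f`)
  (htv : tv = (4 + 2 * A) / (Nr - 1) + K₂ * (Real.sqrt 2 * ρf))
  (h𝔳₁ : 𝔳₁ = 2 * (d * e₀ ^ 2) * tv / klScale e₀ m + 9 * (12 * Ba * ζ))
  (h𝔳₂ : 𝔳₂ = (4 * (d * e₀ ^ 4) + 2 * (d * e₀ ^ 2)) * tv ^ 2 / klScale e₀ m ^ 2 + 2 * (d * e₀ ^ 2) * (4 + 4 * A) / klScale e₀ m +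
    4 * (d * e₀ ^ 2) * tv / klScale e₀ m * (9 * (12 * Ba * ζ)) + 9 * ((12 * Ba + 72 * Ba ^ 2) * ζ ^ 2))
  (h𝔳₃₀ : 𝔳₃₀ = (8 * (d * e₀ ^ 6) + 12 * (d * e₀ ^ 4)) * tv ^ 3 / klScale e₀ m ^ 3 + (12 * (d * e₀ ^ 4) + 6 * (d * e₀ ^ 2)) * (tv * (4 + 4 * A)) / klScale e₀ m ^ 2 +
    2 * (d * e₀ ^ 2) * ε₃₀ / klScale e₀ m +
    3 * (((4 * (d * e₀ ^ 4) + 2 * (d * e₀ ^ 2)) * tv ^ 2 / klScale e₀ m ^ 2 + 2 * (d * e₀ ^ 2) * (4 + 4 * A) / klScale e₀ m) * (9 * (12 * Ba * ζ))) +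
    3 * (2 * (d * e₀ ^ 2) * tv / klScale e₀ m * (9 * ((12 * Ba + 72 * Ba ^ 2) * ζ ^ 2))) + 9 * ((12 * Ba + 216 * Ba ^ 2) * ζ ^ 3))
  (h𝔳₃₁ : 𝔳₃₁ = 2 * (d * e₀ ^ 2) * ε₃₁ / klScale e₀ m)
  (hdv₁ : dv₁ = 4 * klScale e₀ m * tv) (hwv₁ : wv₁ = 2 * (tv * G₀ + 2 * klScale e₀ m * G₁ + G₀ * G₁)) (hdv₂ : dv₂ = 2 * (tv ^ 2 + 2 * klScale e₀ m * ε₂))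
  (hwv₂ : wv₂ = 2 * (ε₂ * G₀ + 2 * tv * G₁ + 2 * klScale e₀ m * G₂ + G₁ ^ 2 + G₀ * G₂))
  (hdv₃₀ : dv₃₀ = 2 * (3 * tv * ε₂ + 2 * klScale e₀ m * ε₃₀)) (hdv₃₁ : dv₃₁ = 4 * klScale e₀ m * ε₃₁)
  (hwv₃₀ : wv₃₀ = 2 * (ε₃₀ * G₀ + ε₃₁ * G₀ + 3 * ε₂ * G₁ + 3 * tv * G₂ + 3 * G₁ * G₂ + G₀ * G₃)) (hwv₃₁ : wv₃₁ = 4 * klScale e₀ m * G₃)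
  (hov₁₀ : ov₁₀ = tv / klScale e₀ m) (hov₁₁ : ov₁₁ = 2 * G₁ / G₀) (hov₂₀ : ov₂₀ = ε₂ / klScale e₀ m + G₁ ^ 2 / (klScale e₀ m * G₀))
  (hov₂₁ : ov₂₁ = 2 * tv * G₁ / (klScale e₀ m * G₀)) (hov₂₂ : ov₂₂ = 2 * G₂ / G₀)
  (hov₃₀ : ov₃₀ = ε₃₀ / klScale e₀ m) (hov₃₁ : ov₃₁ = ε₃₁ / klScale e₀ m + 3 * ε₂ * G₁ / (klScale e₀ m * G₀) + 3 * G₁ * G₂ / (klScale e₀ m * G₀))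
  (hov₃₂ : ov₃₂ = 3 * tv * G₂ / (klScale e₀ m * G₀)) (hov₃₃ : ov₃₃ = 2 * G₃ / G₀)
  (hRv₁₀ : Rv₁₀ = κ * (dv₁ + wv₁) + ov₁₀) (hRv₁₁ : Rv₁₁ = ov₁₁)
  (hRv₂₀ : Rv₂₀ = κ ^ 2 * (dv₁ + wv₁) ^ 2 + κ * (ov₁₀ * (2 * dv₁ + wv₁)) + κ * (dv₂ + wv₂) + ov₂₀) (hRv₂₁ : Rv₂₁ = κ * (ov₁₁ * (2 * dv₁ + wv₁)) + ov₂₁)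
  (hRv₂₂ : Rv₂₂ = ov₂₂)
  (hRv₃₀ : Rv₃₀ = κ ^ 3 * (dv₁ + wv₁) ^ 3 + κ ^ 2 * (ov₁₀ * (3 * dv₁ ^ 2 + 3 * dv₁ * wv₁ + wv₁ ^ 2)) +
    3 * (κ ^ 2 * ((dv₁ + wv₁) * (dv₂ + wv₂)) + κ * (dv₁ * ov₂₀ + ov₁₀ * dv₂ + ov₁₀ * wv₂)) + κ * (dv₃₀ + wv₃₀) + ov₃₀)
  (hRv₃₁ : Rv₃₁ = κ ^ 2 * (ov₁₁ * (3 * dv₁ ^ 2 + 3 * dv₁ * wv₁ + wv₁ ^ 2)) + 3 * (κ * (dv₁ * ov₂₁ + ov₁₁ * dv₂ + ov₁₁ * wv₂)) + κ * (dv₃₁ + wv₃₁) + ov₃₁)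
  (hRv₃₂ : Rv₃₂ = 3 * (κ * (dv₁ * ov₂₂)) + ov₃₂) (hRv₃₃ : Rv₃₃ = ov₃₃)
  (hrv₁₀ : rv₁₀ = Rv₁₀ + 𝔳₁) (hrv₁₁ : rv₁₁ = Rv₁₁) (hrv₂₀ : rv₂₀ = Rv₂₀ + 2 * Rv₁₀ * 𝔳₁ + 𝔳₂) (hrv₂₁ : rv₂₁ = Rv₂₁ + 2 * Rv₁₁ * 𝔳₁) (hrv₂₂ : rv₂₂ = Rv₂₂)
  (hrv₃₀ : rv₃₀ = Rv₃₀ + 3 * Rv₂₀ * 𝔳₁ + 3 * Rv₁₀ * 𝔳₂ + 𝔳₃₀) (hrv₃₁ : rv₃₁ = Rv₃₁ + 3 * Rv₂₁ * 𝔳₁ + 3 * Rv₁₁ * 𝔳₂ + 𝔳₃₁)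
  (hrv₃₂ : rv₃₂ = Rv₃₂ + 3 * Rv₂₂ * 𝔳₁) (hrv₃₃ : rv₃₃ = Rv₃₃)
  -- time
  (hqt₁ : qt₁ = 2 * (d * e₀ ^ 2) * |2 * π / β| / klScale e₀ m) (hqt₂ : qt₂ = (4 * (d * e₀ ^ 4) + 2 * (d * e₀ ^ 2)) * (2 * π / β) ^ 2 / klScale e₀ m ^ 2)
  (hqt₃ : qt₃ = (8 * (d * e₀ ^ 6) + 12 * (d * e₀ ^ 4)) * |2 * π / β| ^ 3 / klScale e₀ m ^ 3)
  (hDt₁ : Dt₁ = 2 * klScale e₀ m * |2 * π / β|) (hDt₂ : Dt₂ = 2 * (2 * π / β) ^ 2)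
  (hθ₁ : θ₁ = κ * Dt₁ + qt₁) (hθ₂ : θ₂ = κ ^ 2 * Dt₁ ^ 2 + κ * Dt₂ + 2 * (κ * Dt₁) * qt₁ + qt₂)
  (hθ₃ : θ₃ = κ ^ 3 * Dt₁ ^ 3 + 3 * (κ ^ 2 * (Dt₁ * Dt₂)) + 3 * ((κ ^ 2 * Dt₁ ^ 2 + κ * Dt₂) * qt₁) + 3 * (κ * Dt₁ * qt₂) + qt₃)
  -- the slot constant dominates the tangent slot plus the transfer
  (htvb : tv + Nt ≤ bs)

include B hA hA3 hADt he hz hz1 hgap h3 hlo hhi hβ hρA hMm hd hd1 hd2 hd3 hd4 hB0 hB hK₂ hNr hLz hν hνs hx hG₀ hG₁ hG₂ hG₃ hε₃₀ hε₃₁ hN₀ hN₁ hN₂ hN₃ hGΛ hA₃x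
  hΛ hΛΛ' hM' hKb₁ hKb₂ hKb₃ hbs hKb₁b hKb₂x hKb₃x hB₁ hB₂ hB₃ hNt0 hNt hρf hκ hC₁ hB₀x hε₂ hζ ht h𝔮₁ h𝔮₂ h𝔮₃₀ h𝔮₃₁
  hd₁ hw₁ hd₂ hw₂ hd₃₀ hd₃₁ hw₃₀ hw₃₁ ho₁₀ ho₁₁ ho₂₀ ho₂₁ ho₂₂ ho₃₀ ho₃₁ ho₃₂ ho₃₃ hR₁₀ hR₁₁ hR₂₀ hR₂₁ hR₂₂ hR₃₀ hR₃₁ hR₃₂ hR₃₃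
  hr₁₀ hr₁₁ hr₂₀ hr₂₁ hr₂₂ hr₃₀ hr₃₁ hr₃₂ hr₃₃ htv h𝔳₁ h𝔳₂ h𝔳₃₀ h𝔳₃₁
  hdv₁ hwv₁ hdv₂ hwv₂ hdv₃₀ hdv₃₁ hwv₃₀ hwv₃₁ hov₁₀ hov₁₁ hov₂₀ hov₂₁ hov₂₂ hov₃₀ hov₃₁ hov₃₂ hov₃₃ hRv₁₀ hRv₁₁ hRv₂₀ hRv₂₁ hRv₂₂ hRv₃₀ hRv₃₁ hRv₃₂ hRv₃₃
  hrv₁₀ hrv₁₁ hrv₂₀ hrv₂₁ hrv₂₂ hrv₃₀ hrv₃₁ hrv₃₂ hrv₃₃ hqt₁ hqt₂ hqt₃ hDt₁ hDt₂ hθ₁ hθ₂ hθ₃ htvb in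
set_option maxHeartbeats 4000000 in
/-- **The per-pair weighted bound for the fat increment pair, every pair** (see the module docstring). [cite: BenfattoGiulianiMastropietro2006, §2.8 (2.81), §3 (3.2)–(3.8)] -/
theorem slicePairWt_bgmFatIncr_le_all
    -- lattice resolution of the band frame's curvature (uniform in the frame vector)
    (hLe : Kb₂ * (2 * π / L) ≤ bs) (hLv : Kb₂ * (2 * π / L * (Real.sqrt 2 * (Nr + 1 / 2))) ≤ bs)
    -- rates, time condition, coefficients, thresholds
    {s₀ ρ ρ₃ k₁ k₂ k₃ : ℝ} (hs₀ : 0 < s₀) (hρ : 0 < ρ) (hρ₃ : 0 < ρ₃)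
    (hk₁ : k₁ = (16 * B₁ + 16) / Λ ^ 2) (hk₂ : k₂ = (32 * B₂ + 144 * B₁ + 128) / Λ ^ 3) (hk₃ : k₃ = (64 * B₃ + 480 * B₂ + 1728 * B₁ + 1536) / Λ ^ 4)
    (htime : (1 / (β * (L : ℝ) ^ 2)) ^ 2 *
        (1 * ((2 * π / β) ^ 3 * ((64 * B₃ + 480 * B₂ + 1728 * B₁ + 1536) * (β * (L : ℝ) ^ 2) / Λ ^ 4)) +
          3 * (θ₁ * ((2 * π / β) ^ 2 * ((32 * B₂ + 144 * B₁ + 128) * (β * (L : ℝ) ^ 2) / Λ ^ 3))) +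
          3 * (θ₂ * ((2 * π / β) * ((16 * B₁ + 16) * (β * (L : ℝ) ^ 2) / Λ ^ 2))) +
          θ₃ * (4 * (β * (L : ℝ) ^ 2) / Λ)) ≤
      (1 / (β * (L : ℝ) ^ 2)) ^ 2 * (4 * (β * (L : ℝ) ^ 2) / Λ) * (4 / (s₀ * (2 * M : ℕ))) ^ 3)
    {C₀ C₁' C₂ C₃ Cv₀ Cv₁ Cv₂ Cv₃ Cw₀ Cw₁ Cw₂ Kc Kw : ℝ}
    (hC₀ : C₀ = 343 * k₃ * (β * (L : ℝ) ^ 2) * bs ^ 3 + 21 * k₂ * (β * (L : ℝ) ^ 2) * bs * b₂ + k₁ * (β * (L : ℝ) ^ 2) * b₃ +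
      3 * r₁₀ * (36 * k₂ * (β * (L : ℝ) ^ 2) * bs ^ 2 + k₁ * (β * (L : ℝ) ^ 2) * b₂) + 15 * r₂₀ * k₁ * (β * (L : ℝ) ^ 2) * bs + r₃₀ * (4 * (β * (L : ℝ) ^ 2) / Λ))
    (hC₁' : C₁' = 21 * k₂ * (β * (L : ℝ) ^ 2) * bs * b₂' + k₁ * (β * (L : ℝ) ^ 2) * b₃' + 3 * r₁₁ * (36 * k₂ * (β * (L : ℝ) ^ 2) * bs ^ 2 + k₁ * (β * (L : ℝ) ^ 2) * b₂) +
      3 * r₁₀ * (k₁ * (β * (L : ℝ) ^ 2) * b₂') + 15 * r₂₁ * k₁ * (β * (L : ℝ) ^ 2) * bs + r₃₁ * (4 * (β * (L : ℝ) ^ 2) / Λ))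
    (hC₂ : C₂ = 3 * r₁₁ * (k₁ * (β * (L : ℝ) ^ 2) * b₂') + 15 * r₂₂ * k₁ * (β * (L : ℝ) ^ 2) * bs + r₃₂ * (4 * (β * (L : ℝ) ^ 2) / Λ))
    (hC₃ : C₃ = r₃₃ * (4 * (β * (L : ℝ) ^ 2) / Λ))
    (hCv₀ : Cv₀ = 343 * k₃ * (β * (L : ℝ) ^ 2) * bs ^ 3 + 21 * k₂ * (β * (L : ℝ) ^ 2) * bs * b₂ + k₁ * (β * (L : ℝ) ^ 2) * b₃ +
      3 * rv₁₀ * (36 * k₂ * (β * (L : ℝ) ^ 2) * bs ^ 2 + k₁ * (β * (L : ℝ) ^ 2) * b₂) + 15 * rv₂₀ * k₁ * (β * (L : ℝ) ^ 2) * bs + rv₃₀ * (4 * (β * (L : ℝ) ^ 2) / Λ))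
    (hCv₁ : Cv₁ = 21 * k₂ * (β * (L : ℝ) ^ 2) * bs * b₂' + k₁ * (β * (L : ℝ) ^ 2) * b₃' + 3 * rv₁₁ * (36 * k₂ * (β * (L : ℝ) ^ 2) * bs ^ 2 + k₁ * (β * (L : ℝ) ^ 2) * b₂) +
      3 * rv₁₀ * (k₁ * (β * (L : ℝ) ^ 2) * b₂') + 15 * rv₂₁ * k₁ * (β * (L : ℝ) ^ 2) * bs + rv₃₁ * (4 * (β * (L : ℝ) ^ 2) / Λ))
    (hCv₂ : Cv₂ = 3 * rv₁₁ * (k₁ * (β * (L : ℝ) ^ 2) * b₂') + 15 * rv₂₂ * k₁ * (β * (L : ℝ) ^ 2) * bs + rv₃₂ * (4 * (β * (L : ℝ) ^ 2) / Λ))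
    (hCv₃ : Cv₃ = rv₃₃ * (4 * (β * (L : ℝ) ^ 2) / Λ))
    (hCw₀ : Cw₀ = 25 * k₂ * (β * (L : ℝ) ^ 2) * bs ^ 2 + k₁ * (β * (L : ℝ) ^ 2) * b₂ + 8 * rv₁₀ * k₁ * (β * (L : ℝ) ^ 2) * bs + rv₂₀ * (4 * (β * (L : ℝ) ^ 2) / Λ))
    (hCw₁ : Cw₁ = k₁ * (β * (L : ℝ) ^ 2) * b₂' + 8 * rv₁₁ * k₁ * (β * (L : ℝ) ^ 2) * bs + rv₂₁ * (4 * (β * (L : ℝ) ^ 2) / Λ))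
    (hCw₂ : Cw₂ = rv₂₂ * (4 * (β * (L : ℝ) ^ 2) / Λ))
    (hKc : Kc = 32 * (β * (L : ℝ) ^ 2) / (π ^ 3 * Λ)) (hKw : Kw = 16 * (β * (L : ℝ) ^ 2) / (π ^ 2 * Λ))
    (th₃ : 4 * C₃ * ρ ^ 3 ≤ Kc) (th₂ : 4 * C₂ * ρ ^ 3 ≤ Kc * x) (th₁ : 4 * C₁' * ρ ^ 3 ≤ Kc * x ^ 2) (th₀ : 4 * C₀ * ρ ^ 3 ≤ Kc * x ^ 3)
    (tv₃ : 4 * Cv₃ * ρ ^ 3 ≤ Kc) (tv₂ : 4 * Cv₂ * ρ ^ 3 ≤ Kc * x) (tv₁ : 4 * Cv₁ * ρ ^ 3 ≤ Kc * x ^ 2) (tv₀ : 4 * Cv₀ * ρ ^ 3 ≤ Kc * x ^ 3)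
    (tw₂ : 3 * Cw₂ * ρ₃ ^ 2 ≤ Kw) (tw₁ : 3 * Cw₁ * ρ₃ ^ 2 ≤ Kw * x) (tw₀ : 3 * Cw₀ * ρ₃ ^ 2 ≤ Kw * x ^ 2) (ω ω' : Fin (sectorCount (m + 1))) :
    ∑ z : TorusSite 1 (2 * M) × TorusSite 2 L,
        (1 + s₀ * |(((z.1 0).valMinAbs : ℤ) : ℝ)| + ρ / x * |(((z.2 0).valMinAbs : ℤ) : ℝ)| + ρ / x * |(((z.2 1).valMinAbs : ℤ) : ℝ)|) *
        ‖∑ q : TorusSite 1 (2 * M) × TorusSite 2 L, (torusChar q.1 z.1 * torusChar q.2 z.2) •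
          ((((1 / (β * (L : ℝ) ^ 2) : ℝ) : ℂ) ^ 2 *
            ((bgmFatMultiplier L M e₀ β (nambuXiCT L μ Ko) (m + 1) ω (⟨(q.1 0).val, ZMod.val_lt (q.1 0)⟩, q.2) *
                bgmFatMultiplier L M e₀ β (nambuXiCT L μ K) (m + 1) ω' (⟨(q.1 0).val, ZMod.val_lt (q.1 0)⟩, q.2) -
              bgmFatMultiplier L M e₀ β (nambuXiCT L μ K) (m + 1) ω (⟨(q.1 0).val, ZMod.val_lt (q.1 0)⟩, q.2) *
                bgmFatMultiplier L M e₀ β (nambuXiCT L μ K) (m + 1) ω' (⟨(q.1 0).val, ZMod.val_lt (q.1 0)⟩, q.2)) *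
              sliceSymbolFnXi (β * (L : ℝ) ^ 2) 0 Λ Λ' (matsubaraFreq β M ⟨(q.1 0).val, ZMod.val_lt (q.1 0)⟩) (nambuXiCT L μ Kb q.2))))‖ ≤
      x * Real.sqrt (524288 * (1 / s₀ + 1) * ((1 + 4 * Real.sqrt 2) ^ 2 * ((2 * Real.sqrt 2 / ρ + 2) * (2 * Real.sqrt 2 / ρ₃ + 2)) + (1 / ρ + 1) ^ 2)) *
        Real.sqrt (24 * (2 * M : ℕ) * (L : ℝ) ^ 2 *
          ((klScale e₀ m * β / π + 1) *
            ((Real.sqrt 2 * L * ((klScale e₀ m + (4 + 4 * A) * ρf ^ 2) / (2 * B.rhomin - 4 * A)) / π + 2) *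
              (Real.sqrt 2 * L * (2 * ρf) / π + 2)))) *
        (B₀x * ((1 / (β * (L : ℝ) ^ 2)) ^ 2 * (4 * (β * (L : ℝ) ^ 2) / Λ))) := by
  have hL : (0 : ℝ) < L := Nat.cast_pos.2 (Nat.pos_of_ne_zero (NeZero.ne L))
  have hπ := Real.pi_pos
  have hlo' : a ≤ μ - A := by linarith only [hlo, he]
  have hhi' : μ + A ≤ b := by linarith only [hhi, he]
  have hKb20 : 0 ≤ Kb₂ := (norm_nonneg _).trans (hKb₂ 0)
  set pF : Fin 2 → ℝ := klFermiPoint μ K (sectorCenter (m + 1) (ω : ℕ)) with hpF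
  set eK : (Fin 2 → ℝ) → ℝ := fun p => frameLevel μ K (WithLp.toLp 2 p) with heK
  set g₀ : ℝ := fderiv ℝ eK pF (Pi.single 0 1) with hg₀
  set g₁ : ℝ := fderiv ℝ eK pF (Pi.single 1 1) with hg₁
  have hγ : 0 < 2 * B.rhomin - 4 * A := by linarith only [hρA]
  have hN0 : 0 < Real.sqrt (g₀ ^ 2 + g₁ ^ 2) := lt_of_lt_of_le hγ (gradient_floor_klFermiPoint B hA hlo' hhi' (sectorCenter (m + 1) (ω : ℕ)))
  -- the integer frame vector
  obtain ⟨v, hv⟩ : ∃ v : Fin 2 → ℤ, v = ![round (Nr * (-g₁ / Real.sqrt (g₀ ^ 2 + g₁ ^ 2))), round (Nr * (g₀ / Real.sqrt (g₀ ^ 2 + g₁ ^ 2)))] :=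
    ⟨_, rfl⟩
  have hv0 : v 0 = round (Nr * (-g₁ / Real.sqrt (g₀ ^ 2 + g₁ ^ 2))) := by rw [hv]; rfl
  have hv1 : v 1 = round (Nr * (g₀ / Real.sqrt (g₀ ^ 2 + g₁ ^ 2))) := by rw [hv]; rfl
  have hNr1 : 1 ≤ Nr := by linarith only [hNr]
  obtain ⟨htan, hvj, hvne⟩ := tangentStep_bounds eK pF (norm_fderiv_frameBand_le hA μ pF) hN0 hNr1 v hv0 hv1 (2 * π / L)
  have hunit : (-g₁ / Real.sqrt (g₀ ^ 2 + g₁ ^ 2)) ^ 2 + (g₀ / Real.sqrt (g₀ ^ 2 + g₁ ^ 2)) ^ 2 = 1 := by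
    have h := (frame_orthonormal hN0).2.1
    rw [neg_div]; exact h
  have hvlen : Nr - 1 ≤ Real.sqrt ((v 0 : ℝ) ^ 2 + (v 1 : ℝ) ^ 2) := by
    have h := sub_one_le_sqrt_sum_sq_round hNr (u := ![-g₁ / Real.sqrt (g₀ ^ 2 + g₁ ^ 2), g₀ / Real.sqrt (g₀ ^ 2 + g₁ ^ 2)]) hunit
    rw [hv0, hv1]
    exact h
  -- the lattice resolution along `v`
  have hvnorm : ‖(WithLp.toLp 2 (fun j => 2 * π / L * (v j : ℝ)) : EuclideanSpace ℝ (Fin 2))‖ ≤ 2 * π / L * (Real.sqrt 2 * (Nr + 1 / 2)) := by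
    rw [norm_toLp_latticeStep]
    refine mul_le_mul_of_nonneg_left ?_ (by positivity)
    have hNr0 : 0 ≤ Nr + 1 / 2 := by linarith only [hNr]
    have h0 := hvj 0
    have h1 := hvj 1
    have hsq0 : (v 0 : ℝ) ^ 2 ≤ (Nr + 1 / 2) ^ 2 := by rw [← sq_abs]; exact pow_le_pow_left₀ (abs_nonneg _) h0 2
    have hsq1 : (v 1 : ℝ) ^ 2 ≤ (Nr + 1 / 2) ^ 2 := by rw [← sq_abs]; exact pow_le_pow_left₀ (abs_nonneg _) h1 2
    calc Real.sqrt ((v 0 : ℝ) ^ 2 + (v 1 : ℝ) ^ 2) ≤ Real.sqrt (2 * (Nr + 1 / 2) ^ 2) := Real.sqrt_le_sqrt (by linarith only [hsq0, hsq1])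
      _ = Real.sqrt 2 * (Nr + 1 / 2) := by rw [Real.sqrt_mul (by norm_num), Real.sqrt_sq hNr0]
  have hLv' : Kb₂ * ‖(WithLp.toLp 2 (fun j => 2 * π / L * (v j : ℝ)) : EuclideanSpace ℝ (Fin 2))‖ ≤ bs :=
    (mul_le_mul_of_nonneg_left hvnorm hKb20).trans hLv
  exact slicePairWt_bgmFatIncr_le B Ko Kb hA hA3 hADt he hz hz1 hgap h3 hlo hhi hβ hρA m hMm hd hd1 hd2 hd3 hd4 hB0 hB hK₂ hNr hLz hν hνs hx hG₀ hG₁ hG₂ hG₃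
    hε₃₀ hε₃₁ hN₀ hN₁ hN₂ hN₃ hGΛ hA₃x hΛ hΛΛ' hM' hKb₁ hKb₂ hKb₃ hbs hKb₁b hKb₂x hKb₃x hB₁ hB₂ hB₃ hNt0 hNt hρf hκ hC₁ hB₀x hε₂ hζ ht h𝔮₁ h𝔮₂ h𝔮₃₀ h𝔮₃₁
    hd₁ hw₁ hd₂ hw₂ hd₃₀ hd₃₁ hw₃₀ hw₃₁ ho₁₀ ho₁₁ ho₂₀ ho₂₁ ho₂₂ ho₃₀ ho₃₁ ho₃₂ ho₃₃ hR₁₀ hR₁₁ hR₂₀ hR₂₁ hR₂₂ hR₃₀ hR₃₁ hR₃₂ hR₃₃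
    hr₁₀ hr₁₁ hr₂₀ hr₂₁ hr₂₂ hr₃₀ hr₃₁ hr₃₂ hr₃₃ htv h𝔳₁ h𝔳₂ h𝔳₃₀ h𝔳₃₁
    hdv₁ hwv₁ hdv₂ hwv₂ hdv₃₀ hdv₃₁ hwv₃₀ hwv₃₁ hov₁₀ hov₁₁ hov₂₀ hov₂₁ hov₂₂ hov₃₀ hov₃₁ hov₃₂ hov₃₃ hRv₁₀ hRv₁₁ hRv₂₀ hRv₂₁ hRv₂₂ hRv₃₀ hRv₃₁ hRv₃₂ hRv₃₃
    hrv₁₀ hrv₁₁ hrv₂₀ hrv₂₁ hrv₂₂ hrv₃₀ hrv₃₁ hrv₃₂ hrv₃₃ hqt₁ hqt₂ hqt₃ hDt₁ hDt₂ hθ₁ hθ₂ hθ₃ htvb ω ω' v hvne hvj hvlen htan _ rfl hLe hLv'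
    hs₀ hρ hρ₃ hk₁ hk₂ hk₃ htime hC₀ hC₁' hC₂ hC₃ hCv₀ hCv₁ hCv₂ hCv₃ hCw₀ hCw₁ hCw₂ hKc hKw th₃ th₂ th₁ th₀ tv₃ tv₂ tv₁ tv₀ tw₂ tw₁ tw₀

end PairBoundAll

end Summit.HubbardSuperconductivity.HubbardSuperconductivity.Theorems.TorusFourierL2

end
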